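/-
Copyright: the b2b-balaban T⁴-continuum CRUX team, row NE7b OWNER lineage `t4-ne7b-p1` (gen 124). Project licence.
-/
import Summits.QuantumFields.BalabanUV.T4Continuum.Spine.NE7b.SupZdCoarseInverseLipschitz

/-!
# THE INFINITE-VOLUME RESPONSE KERNEL IS LIPSCHITZ IN THE POTENTIAL, IN THE DECAY CURRENCY: for `V₁, V₂ : ℤ^d → [−λ, Λ]` with
# `|V₁ − V₂| ≤ D` (`d ≥ 3`, every mesh), the responses `h^i_{b₀} = Σ′_{b′}M_i(b′,b₀)Ψ^i_{b′}` of (200) satisfy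
# `|h¹_{b₀}(p) − h²_{b₀}(p)| ≤ C·D·e^{−δ|blk n p − b₀|₁}`, `(C, δ)` from `(d, a, λ, Λ)` ONLY — (202)'s Lipschitz bound for `M`, (182)'s for the block
# columns, the product rule under the series and (200)'s convolution of exponentials; the infinite-volume twin of (161)∕(177) for the
# response (row NE7b, node U5c; (180)∕(182)∕(194)∕(200)∕(202) BY NAME; [folklore])

Cell `pub-balaban`, sub-cell `t4`, spine estimate NE7b (`T4WeightBudget.RelWeightBound`; the cell's OWN estimate — NOT PRINTED in
[Bałaban 1983–89], NOT PROVED).  Crux-route work under `Spine/NE7b/` by the row OWNER (`t4-ne7b-p1` gen 124, file (210)) under FREEZE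
(0)'s crux-prover clause; NOTHING of Bałaban's is named as a Lean object, valued or asserted; no `T4Continuum/Support` leaf typed; no `def`,
no notation (both responses WRITTEN OUT; `Ψ_i`, `M_i` ANY data with their displayed properties); zero `sorry`.  Imports (BY NAME): the
OWNER's (202) `…SupZdCoarseInverseLipschitz` (`zd_coarse_inverse_lipschitz`; through it (200) `tsum_exp_conv_le`, `zd_response_kernel`, (194)
`zd_coarse_section_inverse`, (182) `zd_propagator_lipschitz_potential`, (181) `zd_bounded_solution_unique`, (180) `zd_propagator_exists`),
Mathlib's `Summable.tsum_sub`, `norm_tsum_le_tsum_norm`, `Summable.tsum_le_tsum`.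

WHY (located).  A `C¹` statement about the infinite-volume RG map in the background needs, beyond the Hessian ((202)), the response
operator's dependence on `V`.  Termwise `M₁Ψ₁ − M₂Ψ₂ = (M₁ − M₂)Ψ₁ + M₂(Ψ₁ − Ψ₂)`: the first factor pair is `C_LDe^{−δ_L|b′ − b₀|₁}·
C₀e^{−δ₀|blk n p − b′|₁}` ((202), (180)+(181)), the second `c₁e^{−δ₁|b′ − b₀|₁}·C_PDe^{−δ_P|blk n p − b′|₁}` ((194)'s section decay in the cube
limit, (182) with the common block source `𝟙_{B n b′}`); at the common rate `m` both are `D·const·e^{−m|b′−b₀|₁}e^{−m|blk n p−b′|₁}`, whose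
series is `≤ K_{m∕2}e^{−(m∕2)|blk n p − b₀|₁}` ((200) §1).

WHAT IS PROVED ([folklore]): **`zd_response_lipschitz`** (`∃ C δ > 0`: for ALL `n`, `V₁, V₂` of the class with `|V₁ − V₂| ≤ D`, block columns
`Ψ₁, Ψ₂`, cube limits `M₁, M₂`, all `b₀, p`: `|Σ′_{b′}M₁(b′,b₀)Ψ¹_{b′}(p) − Σ′_{b′}M₂(b′,b₀)Ψ²_{b′}(p)| ≤ CDe^{−δ|blk n p − b₀|₁}`); §2 toy.

HONEST (what this is NOT).  The response only (the covariance's Lipschitz bound composes the same way with (201) and is not typed);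
dependence on the POTENTIAL only (composition with the Nemytskii map by name); the LINEAR column only; `d ≥ 3` only; scalar skeleton
((A3), NC-NE7b-α UNRULED); nothing of the covariant propagators of [B4]–[B6]; nothing of Bałaban's asserted.  BY-NAME EFFECT ON THE WALL:
NONE.  NE7b NOT PRINTED ∕ NOT PROVED; spine PROVED 0∕9; rung (B)+1 — the programme's measures remain FINITE-torus statements; NOT the mass
gap, NOT Clay.  HONEST DEPENDENCY: continuum YM on T⁴ ⇐ BetaPertH ∧ nine spine estimates (0∕9 proved); BetaPertH ⇐ (D1) ∧ (D4) ∧ CAP+tail;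
G-an2-4 gates asym, D1 and NE2∕3∕4.
-/

set_option autoImplicit false

noncomputable section

namespace Summit.QuantumFields.BalabanUV.T4Continuum.NE7b.SupZdResponseLipschitz

open Real Filter Topology
open Literature.MathematicalPhysics.QuantumFieldTheory.Balaban1983to89
open B6QGQLower276 (X e blk B side chart mem_B sum_B sum_B_const card_cube blk_chart)
open SupZdPropagatorLimit (zd_propagator_exists)
open SupZdPropagatorUniqueness (zd_bounded_solution_unique)
open SupZdPropagatorProfile (zd_propagator_lipschitz_potential)
open SupZdCoarseInverse (zd_coarse_section_inverse)
open SupZdResponseKernel (tsum_exp_conv_le zd_response_kernel)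
open SupZdCoarseInverseLipschitz (zd_coarse_inverse_lipschitz)

variable {d : ℕ}

/-! ## §1. THE END: the infinite-volume response kernel is Lipschitz in the potential, in the decay currency -/

/-- **HEADLINE — `|h¹_{b₀}(p) − h²_{b₀}(p)| ≤ C·‖V₁ − V₂‖_∞·e^{−δ|blk n p − b₀|₁}`**: `d ≥ 3`, `a > 0`, `λ < min(2,a)`, `Λ ≥ 0` ⟹ `∃ C δ > 0` (from
`(d, a, λ, Λ)` ONLY) such that for ALL `n`, potentials `V₁, V₂ : ℤ^d → [−λ, Λ]` with `|V₁ − V₂| ≤ D`, bounded block columns `Ψ₁, Ψ₂`, cube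
limits `M₁, M₂`, and every `b₀, p`: the infinite-volume responses `h^i_{b₀} = Σ′_{b′}M_i(b′,b₀)Ψ^i_{b′}` ((200)) differ by at most
`C·D·e^{−δ|blk n p − b₀|₁}` — termwise `(M₁ − M₂)Ψ₁ + M₂(Ψ₁ − Ψ₂)` with (202)'s Lipschitz bound for `M`, (182)'s for the block columns,
(180)∕(194)'s decay of the other factors, and (200)'s convolution of exponentials. [folklore] -/
theorem zd_response_lipschitz (hd : 3 ≤ d) (a : ℝ) (ha : 0 < a) {lam Lam : ℝ} (hlam : lam < min 2 a) (hLam : 0 ≤ Lam) :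
    ∃ C δ : ℝ, 0 < C ∧ 0 < δ ∧ ∀ (n : ℕ) (V₁ V₂ : X d → ℝ), (∀ p, -lam ≤ V₁ p) → (∀ p, V₁ p ≤ Lam) →
      (∀ p, -lam ≤ V₂ p) → (∀ p, V₂ p ≤ Lam) → ∀ D : ℝ, (∀ p, |V₁ p - V₂ p| ≤ D) →
      ∀ (Ψ₁ Ψ₂ : X d → X d → ℝ) (B₁ B₂ : X d → ℝ), (∀ b' p, |Ψ₁ b' p| ≤ B₁ b') → (∀ b' p, |Ψ₂ b' p| ≤ B₂ b') →
      (∀ b' p, ((n : ℝ) + 1) ^ 2 * ∑ μ, (2 * Ψ₁ b' p - Ψ₁ b' (p + e μ) - Ψ₁ b' (p - e μ))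
        + a / ((n : ℝ) + 1) ^ d * ∑ q ∈ B n (blk n p), Ψ₁ b' q + V₁ p * Ψ₁ b' p = if blk n p = b' then 1 else 0) →
      (∀ b' p, ((n : ℝ) + 1) ^ 2 * ∑ μ, (2 * Ψ₂ b' p - Ψ₂ b' (p + e μ) - Ψ₂ b' (p - e μ))
        + a / ((n : ℝ) + 1) ^ d * ∑ q ∈ B n (blk n p), Ψ₂ b' q + V₂ p * Ψ₂ b' p = if blk n p = b' then 1 else 0) →
      ∀ (M₁ M₂ : X d → X d → ℝ),
      (∀ b b' : X d, Tendsto (fun R : ℕ =>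
          if h : b ∈ (Fintype.piFinset fun _ : Fin d => Finset.Icc (-(R : ℤ)) R) ∧
              b' ∈ (Fintype.piFinset fun _ : Fin d => Finset.Icc (-(R : ℤ)) R)
            then (Matrix.of fun c c' : ↥(Fintype.piFinset fun _ : Fin d => Finset.Icc (-(R : ℤ)) R) =>
              (((n : ℝ) + 1) ^ d)⁻¹ * ∑ q ∈ B n (c : X d), Ψ₁ (c' : X d) q)⁻¹ ⟨b, h.1⟩ ⟨b', h.2⟩ else 0)
        atTop (𝓝 (M₁ b b'))) →
      (∀ b b' : X d, Tendsto (fun R : ℕ =>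
          if h : b ∈ (Fintype.piFinset fun _ : Fin d => Finset.Icc (-(R : ℤ)) R) ∧
              b' ∈ (Fintype.piFinset fun _ : Fin d => Finset.Icc (-(R : ℤ)) R)
            then (Matrix.of fun c c' : ↥(Fintype.piFinset fun _ : Fin d => Finset.Icc (-(R : ℤ)) R) =>
              (((n : ℝ) + 1) ^ d)⁻¹ * ∑ q ∈ B n (c : X d), Ψ₂ (c' : X d) q)⁻¹ ⟨b, h.1⟩ ⟨b', h.2⟩ else 0)
        atTop (𝓝 (M₂ b b'))) →
      ∀ b₀ p : X d, |∑' b' : X d, M₁ b' b₀ * Ψ₁ b' p - ∑' b' : X d, M₂ b' b₀ * Ψ₂ b' p|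
        ≤ C * D * exp (-(δ * ∑ i, (((blk n p i - b₀ i).natAbs : ℕ) : ℝ))) := by
  classical
  obtain ⟨C₀, δ₀, hC₀, hδ₀, H180⟩ := zd_propagator_exists (d := d) hd a ha hlam hLam
  obtain ⟨CP, δP, hCP, hδP, H182⟩ := zd_propagator_lipschitz_potential (d := d) hd a ha hlam hLam
  obtain ⟨c₁, δ₁, hc₁, hδ₁, H4⟩ := zd_coarse_section_inverse (d := d) hd a ha hlam hLam
  obtain ⟨CL, δL, hCL, hδL, H202⟩ := zd_coarse_inverse_lipschitz (d := d) hd a ha hlam hLam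
  obtain ⟨Cr, δr, hCr, hδr, H200⟩ := zd_response_kernel (d := d) hd a ha hlam hLam
  set m : ℝ := min (min δ₀ δP) (min δ₁ δL) with hm
  have hm0 : 0 < m := lt_min (lt_min hδ₀ hδP) (lt_min hδ₁ hδL)
  have hmδ₀ : m ≤ δ₀ := (min_le_left _ _).trans (min_le_left _ _)
  have hmδP : m ≤ δP := (min_le_left _ _).trans (min_le_right _ _)
  have hmδ₁ : m ≤ δ₁ := (min_le_right _ _).trans (min_le_left _ _)
  have hmδL : m ≤ δL := (min_le_right _ _).trans (min_le_right _ _)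
  set K : ℝ := (2 * (1 - exp (-(m / 2)))⁻¹) ^ d with hK
  have hK0 : 0 < K := pow_pos (mul_pos two_pos (inv_pos.2 (sub_pos.2 (exp_lt_one_iff.2 (by linarith))))) d
  refine ⟨(CL * C₀ + c₁ * CP) * K, m / 2, by positivity, by positivity, ?_⟩
  intro n V₁ V₂ hV₁ hV₁' hV₂ hV₂' D hD Ψ₁ Ψ₂ B₁ B₂ hΨ₁B hΨ₂B hΨ₁ hΨ₂ M₁ M₂ hM₁ hM₂ b₀ p
  have hD0 : 0 ≤ D := (abs_nonneg _).trans (hD 0)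
  have hweak : ∀ {x C δ : ℝ} (c c' : X d), 0 ≤ C → m ≤ δ → |x| ≤ C * exp (-(δ * ∑ i, (((c i - c' i).natAbs : ℕ) : ℝ))) →
      |x| ≤ C * exp (-(m * ∑ i, (((c i - c' i).natAbs : ℕ) : ℝ))) := fun c c' hC hδ h =>
    h.trans (mul_le_mul_of_nonneg_left (exp_le_exp.2 (by
      nlinarith [show (0:ℝ) ≤ ∑ i, (((c i - c' i).natAbs : ℕ) : ℝ) by positivity])) hC)
  -- the four ingredients at rate `m`
  have hΨ₁d : ∀ b' q, |Ψ₁ b' q| ≤ C₀ * exp (-(m * ∑ i, (((blk n q i - b' i).natAbs : ℕ) : ℝ))) := by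
    intro b' q
    obtain ⟨v, hveq, hvdec⟩ := H180 n V₁ hV₁ hV₁' b' 1 (fun p => if blk n p = b' then (1 : ℝ) else 0)
      (fun p hp => by rw [if_neg hp]) (fun p => by split_ifs <;> simp)
    have hvB : ∀ p, |v p| ≤ C₀ * 1 := fun p =>
      (le_mul_of_one_le_left (abs_nonneg _) (one_le_exp (by positivity))).trans (hvdec p)
    have hΨv : Ψ₁ b' = v := zd_bounded_solution_unique hd a ha hlam hLam n V₁ hV₁ hV₁' _ (Ψ₁ b') v (hΨ₁B b') hvB (hΨ₁ b') hveq
    refine hweak (blk n q) b' hC₀.le hmδ₀ ?_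
    have h := hvdec q
    rw [← hΨv, mul_one] at h
    have hE := exp_pos (δ₀ * ∑ i, (((blk n q i - b' i).natAbs : ℕ) : ℝ))
    rw [exp_neg, ← div_eq_mul_inv, le_div_iff₀ hE, mul_comm]; exact h
  have hΨLd : ∀ b' q, |Ψ₁ b' q - Ψ₂ b' q| ≤ CP * D * exp (-(m * ∑ i, (((blk n q i - b' i).natAbs : ℕ) : ℝ))) := by
    intro b' q
    refine hweak (blk n q) b' (by positivity) hmδP ?_
    have h := H182 n V₁ V₂ hV₁ hV₁' hV₂ hV₂' D hD b' 1 (fun p => if blk n p = b' then (1 : ℝ) else 0)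
      (fun p hp => by rw [if_neg hp]) (fun p => by split_ifs <;> simp) (Ψ₁ b') (Ψ₂ b') (B₁ b') (B₂ b') (hΨ₁B b') (hΨ₂B b')
      (hΨ₁ b') (hΨ₂ b') q
    rw [mul_one] at h
    have hE := exp_pos (δP * ∑ i, (((blk n q i - b' i).natAbs : ℕ) : ℝ))
    rw [exp_neg, ← div_eq_mul_inv, le_div_iff₀ hE, mul_comm]; exact h
  have hM₂d : ∀ b b', |M₂ b b'| ≤ c₁ * exp (-(m * ∑ i, (((b i - b' i).natAbs : ℕ) : ℝ))) := fun b b' =>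
    hweak b b' hc₁.le hmδ₁ (le_of_tendsto' (hM₂ b b').abs fun R => by
      split_ifs with h
      · exact (H4 n V₂ hV₂ hV₂' Ψ₂ B₂ hΨ₂B hΨ₂ _ _ (Finset.Subset.refl _)).1 ⟨b, h.1⟩ ⟨b', h.2⟩
      · rw [abs_zero]; positivity)
  have hMLd : ∀ b b', |M₁ b b' - M₂ b b'| ≤ CL * D * exp (-(m * ∑ i, (((b i - b' i).natAbs : ℕ) : ℝ))) := fun b b' =>
    hweak b b' (by positivity) hmδL (H202 n V₁ V₂ hV₁ hV₁' hV₂ hV₂' D hD Ψ₁ Ψ₂ B₁ B₂ hΨ₁B hΨ₂B hΨ₁ hΨ₂ M₁ M₂ hM₁ hM₂ b b')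
  -- termwise: `M₁Ψ₁ − M₂Ψ₂ = (M₁ − M₂)Ψ₁ + M₂(Ψ₁ − Ψ₂)`
  have hs₁ := (H200 n V₁ hV₁ hV₁' Ψ₁ B₁ hΨ₁B hΨ₁ M₁ hM₁ b₀).1 p
  have hs₂ := (H200 n V₂ hV₂ hV₂' Ψ₂ B₂ hΨ₂B hΨ₂ M₂ hM₂ b₀).1 p
  rw [← hs₁.tsum_sub hs₂]
  have hdom : ∀ b', |M₁ b' b₀ * Ψ₁ b' p - M₂ b' b₀ * Ψ₂ b' p| ≤ (CL * C₀ + c₁ * CP) * D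
      * (exp (-(m * ∑ i, (((b' i - b₀ i).natAbs : ℕ) : ℝ))) * exp (-(m * ∑ i, (((blk n p i - b' i).natAbs : ℕ) : ℝ)))) := by
    intro b'
    have e1 := hMLd b' b₀; have e2 := hΨ₁d b' p; have e3 := hM₂d b' b₀; have e4 := hΨLd b' p
    calc |M₁ b' b₀ * Ψ₁ b' p - M₂ b' b₀ * Ψ₂ b' p|
        = |(M₁ b' b₀ - M₂ b' b₀) * Ψ₁ b' p + M₂ b' b₀ * (Ψ₁ b' p - Ψ₂ b' p)| := by ring_nf
      _ ≤ |M₁ b' b₀ - M₂ b' b₀| * |Ψ₁ b' p| + |M₂ b' b₀| * |Ψ₁ b' p - Ψ₂ b' p| := by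
          rw [← abs_mul, ← abs_mul]; exact abs_add_le _ _
      _ ≤ (CL * D * exp (-(m * ∑ i, (((b' i - b₀ i).natAbs : ℕ) : ℝ)))) * (C₀ * exp (-(m * ∑ i, (((blk n p i - b' i).natAbs : ℕ) : ℝ))))
          + (c₁ * exp (-(m * ∑ i, (((b' i - b₀ i).natAbs : ℕ) : ℝ)))) * (CP * D * exp (-(m * ∑ i, (((blk n p i - b' i).natAbs : ℕ) : ℝ)))) :=
          add_le_add (mul_le_mul e1 e2 (abs_nonneg _) (by positivity)) (mul_le_mul e3 e4 (abs_nonneg _) (by positivity))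
      _ = _ := by ring
  obtain ⟨hcs, hcb⟩ := tsum_exp_conv_le hm0 b₀ (blk n p)
  have h1 : |∑' b' : X d, (M₁ b' b₀ * Ψ₁ b' p - M₂ b' b₀ * Ψ₂ b' p)| ≤ ∑' b' : X d, |M₁ b' b₀ * Ψ₁ b' p - M₂ b' b₀ * Ψ₂ b' p| := by
    have := norm_tsum_le_tsum_norm (hs₁.sub hs₂).norm; simpa only [Real.norm_eq_abs] using this
  have h2 := (hs₁.sub hs₂).abs.tsum_le_tsum hdom (hcs.mul_left _)
  rw [Summable.tsum_mul_left _ hcs] at h2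
  have h3 := mul_le_mul_of_nonneg_left hcb (show 0 ≤ (CL * C₀ + c₁ * CP) * D by positivity)
  calc |∑' b' : X d, (M₁ b' b₀ * Ψ₁ b' p - M₂ b' b₀ * Ψ₂ b' p)|
      ≤ (CL * C₀ + c₁ * CP) * D * ((2 * (1 - exp (-(m / 2)))⁻¹) ^ d * exp (-(m / 2 * ∑ i, (((blk n p i - b₀ i).natAbs : ℕ) : ℝ)))) :=
        h1.trans (h2.trans h3)
    _ = (CL * C₀ + c₁ * CP) * K * D * exp (-(m / 2 * ∑ i, (((blk n p i - b₀ i).natAbs : ℕ) : ℝ))) := by rw [hK]; ring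

/-! ## §2. Toy -/

/-- Toy (`d = 3`, `a = 1`, `λ = 0`, `Λ = 1`): the Lipschitz constants of the response exist. -/
example : ∃ C δ : ℝ, 0 < C ∧ 0 < δ :=
  let ⟨C, δ, hC, hδ, _⟩ := zd_response_lipschitz (d := 3) le_rfl 1 one_pos (lam := 0) (Lam := 1)
    (by rw [min_eq_right (by norm_num : (1 : ℝ) ≤ 2)]; norm_num) zero_le_one
  ⟨C, δ, hC, hδ⟩

end Summit.QuantumFields.BalabanUV.T4Continuum.NE7b.SupZdResponseLipschitz
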